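import Summits.NavierStokesRegularity.NavierStokesRegularity.Theorems.ExtremiserTransienceNearExtremalTransienceExtremiserLiouvilleConstantSpeedSlideLayerInequality
import Summits.NavierStokesRegularity.NavierStokesRegularity.Theorems.ExtremiserTransienceNearExtremalTransienceExtremiserLiouvilleConstantSpeedSlideGradientL4General
import Summits.NavierStokesRegularity.NavierStokesRegularity.Theorems.ExtremiserTransienceNearExtremalTransienceExtremiserLiouvilleConstantSpeedSlideHessianFrobenius
import HarnessLib

/-!
# Crux `ExtremiserTransience.NearExtremalTransience` (stmt-NavierStokesRegularity-21883), line `extremiser_liouville`,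
# stub K1b — THE LAYER INEQUALITY IN CLOSED FORM (cubic and quartic terms eliminated; record §3/§15/§18)

`--supports stmt-NavierStokesRegularity-21883` (helper).  Author: prover seat `ns-el-k1b` (g9).

`slideLayerInequality` (p745614) controls `Pal·I₁ + Ens·F₂` (`I₁ = ∫g′|Dv|²_F`, `F₂ = Σₖ∫g′|D∂ₖv|²_F`) by `|S|·(128∫g′‖Dv‖³ + 40σ∫|g″|‖Dv‖²)
+ κ⋆²Ens(2∫g′|Dv|⁴_F + M²Err)`.  Here the cubic and quartic gradient terms are eliminated: Young `‖Dv‖³ ≤ ½(λ|Dv|²_F + λ⁻¹|Dv|⁴_F)`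
(`‖Dv‖² ≤ |Dv|²_F`, p745048), the weighted `L⁴` interpolation (`…SlideGradientL4General`, applied to `V = v − c`, `‖v − c‖ ≤ σ` on
`supp g′ ∪ supp g″`, `‖Dv‖ ≤ B`): `∫g′|Dv|⁴_F ≤ 4σB∫|g″||Dv|²_F + 108σ²∫g′‖D²v‖²`, and `‖D²v‖² ≤ Σₖ|D∂ₖv|²_F` (p745048).  Result, for every
`λ > 0`, with `J = ∫|g″(x₂)|·|Dv|²_F`:
```
  (κ⋆²M²/4)(Pal·I₁ + Ens·F₂) ≤ 64λ|S|·I₁ + (64|S|/λ + 2κ⋆²Ens)·(4σB·J + 108σ²·F₂) + 40σ|S|·J + κ⋆²Ens·M²·Err,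
```
so that the absorption of R6b is now a matter of choosing `λ` and the height `a` (`σ = σ(a) → 0`, p741683) against the normalisation
`|S| = κ⋆M√(Ens·Pal)` (hatt); what is left after that is the decay bookkeeping in `a` (⇒ p733230 / p742912).
* `cube_le_young` : `P³ ≤ ½(λF + F²/λ)` for `P² ≤ F`, `P⁴ ≤ F²`;
* `integral_layerCubic_le`, `integral_layerQuartic_le` : the cubic and the quartic line;
* `slideLayerInequality_closed` : the displayed inequality.

WHAT THIS IS NOT: K1b is NOT proved; nothing here proves NS regularity. [folklore]
-/

noncomputable section

open Set Filter Topology MeasureTheory Metric Function InnerProductSpace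
open scoped ENNReal NNReal Topology InnerProductSpace RealInnerProductSpace ContDiff
open Literature.Analysis.FluidPDE Literature.Analysis

namespace Summit.NavierStokesRegularity.NavierStokesRegularity.Theorems

-- the problem directory repeats the summit name (`NavierStokesRegularity/NavierStokesRegularity`)
set_option linter.dupNamespace false

namespace ExtremiserLiouville

open DepletionLadder.KStar

variable {v : EuclideanSpace ℝ (Fin 3) → EuclideanSpace ℝ (Fin 3)} {c : EuclideanSpace ℝ (Fin 3)} {g : ℝ → ℝ}

/-- Young for the cubic term: `P³ ≤ ½(λF + F²/λ)` if `P² ≤ F`, `P⁴ ≤ F²`, `λ > 0`. [folklore] -/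
theorem cube_le_young {P F lam : ℝ} (h2 : P ^ 2 ≤ F) (h4 : P ^ 4 ≤ F ^ 2) (hl : 0 < lam) :
    P ^ 3 ≤ (1 / 2) * (lam * F + (1 / lam) * F ^ 2) := by
  have y : 2 * P ^ 3 * lam ≤ (lam * P ^ 2 + (1 / lam) * P ^ 4) * lam := by
    have e1 : (lam * P ^ 2 + (1 / lam) * P ^ 4) * lam = lam ^ 2 * P ^ 2 + P ^ 4 := by
      field_simp
    rw [e1]
    nlinarith [sq_nonneg (lam * P - P ^ 2)]
  have y1 : 2 * P ^ 3 ≤ lam * P ^ 2 + (1 / lam) * P ^ 4 := le_of_mul_le_mul_right y hl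
  have hl' : 0 ≤ 1 / lam := by positivity
  nlinarith [mul_le_mul_of_nonneg_left h2 hl.le, mul_le_mul_of_nonneg_left h4 hl']

/-- **The cubic line**: `∫g′‖Dv‖³ ≤ ½(λ∫g′|Dv|²_F + λ⁻¹∫g′|Dv|⁴_F)` (`g′ ≥ 0` bounded, `‖Dv‖ ≤ B`, `Dv ∈ L²`). [folklore] -/
theorem integral_layerCubic_le (hv : ContDiff ℝ ∞ v) {B K1 : ℝ} (hB : ∀ x, ‖fderiv ℝ v x‖ ≤ B)
    (hg1 : ContDiff ℝ 1 (deriv g)) (hγ0 : ∀ s, 0 ≤ deriv g s) (hK1 : ∀ s, |deriv g s| ≤ K1)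
    (h1 : ∫⁻ x, ‖iteratedFDeriv ℝ 1 v x‖ₑ ^ 2 < ⊤) {lam : ℝ} (hlam : 0 < lam) :
    (∫ x : EuclideanSpace ℝ (Fin 3), deriv g (x 2) * ‖fderiv ℝ v x‖ ^ 3) ≤ (1 / 2) * (lam * (∫ x : EuclideanSpace ℝ (Fin 3), deriv g (x 2) * frobeniusNormSq (fderiv ℝ v x)) + (1 / lam) * (∫ x : EuclideanSpace ℝ (Fin 3), deriv g (x 2) * frobeniusNormSq (fderiv ℝ v x) ^ 2)) := by
  have hK10 : 0 ≤ K1 := (abs_nonneg _).trans (hK1 0)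
  have hB0 : 0 ≤ B := (norm_nonneg _).trans (hB 0)
  obtain ⟨-, iP2⟩ := integrable_sq_curl_and_fderiv hv h1
  have cg1 : Continuous fun x : EuclideanSpace ℝ (Fin 3) => deriv g (x 2) := hg1.continuous.comp (PiLp.continuous_apply 2 _ (2 : Fin 3))
  have cF : Continuous fun x : EuclideanSpace ℝ (Fin 3) => frobeniusNormSq (fderiv ℝ v x) := continuous_frobeniusNormSq_fderiv hv (by simp)
  have cP : Continuous fun x : EuclideanSpace ℝ (Fin 3) => ‖fderiv ℝ v x‖ := (hv.continuous_fderiv (by simp)).norm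
  have hF0 : ∀ x : EuclideanSpace ℝ (Fin 3), 0 ≤ frobeniusNormSq (fderiv ℝ v x) := fun x => frobeniusNormSq_nonneg _
  have frob_le : ∀ x : EuclideanSpace ℝ (Fin 3), frobeniusNormSq (fderiv ℝ v x) ≤ 3 * ‖fderiv ℝ v x‖ ^ 2 := fun x => by
    rw [frobeniusNormSq_eq_sum (EuclideanSpace.basisFun (Fin 3) ℝ)]
    have := sum_sq_norm_apply_le_card_mul_sq_opNorm (EuclideanSpace.basisFun (Fin 3) ℝ) (fderiv ℝ v x)
    rwa [Fintype.card_fin, Nat.cast_ofNat] at this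
  have iI1 : Integrable (fun x : EuclideanSpace ℝ (Fin 3) => deriv g (x 2) * frobeniusNormSq (fderiv ℝ v x)) volume := by
    refine (iP2.const_mul (K1 * 3)).mono' (cg1.mul cF).aestronglyMeasurable (Eventually.of_forall fun x => ?_)
    rw [Real.norm_eq_abs, abs_mul, abs_of_nonneg (hF0 x)]
    nlinarith [mul_le_mul (hK1 (x 2)) (frob_le x) (hF0 x) hK10]
  have iFR4 : Integrable (fun x : EuclideanSpace ℝ (Fin 3) => deriv g (x 2) * frobeniusNormSq (fderiv ℝ v x) ^ 2) volume := by
    refine (iP2.const_mul (K1 * 9 * B ^ 2)).mono' (cg1.mul (cF.pow 2)).aestronglyMeasurable (Eventually.of_forall fun x => ?_)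
    rw [Real.norm_eq_abs, abs_mul, abs_of_nonneg (sq_nonneg (frobeniusNormSq (fderiv ℝ v x)))]
    have h1' := frob_le x; have hP := norm_nonneg (fderiv ℝ v x); have h3 := hF0 x
    have h4 : ‖fderiv ℝ v x‖ ^ 2 ≤ B ^ 2 := pow_le_pow_left₀ hP (hB x) 2
    have : frobeniusNormSq (fderiv ℝ v x) ^ 2 ≤ (3 * ‖fderiv ℝ v x‖ ^ 2) * (3 * B ^ 2) := by
      rw [sq]; exact mul_le_mul h1' (h1'.trans (by nlinarith)) h3 (by positivity)
    nlinarith [mul_le_mul (hK1 (x 2)) this (sq_nonneg _) hK10]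
  have iP3 : Integrable (fun x : EuclideanSpace ℝ (Fin 3) => deriv g (x 2) * ‖fderiv ℝ v x‖ ^ 3) volume := by
    refine (iP2.const_mul (K1 * B)).mono' (cg1.mul (cP.pow 3)).aestronglyMeasurable (Eventually.of_forall fun x => ?_)
    rw [Real.norm_eq_abs, abs_mul, abs_of_nonneg (hγ0 _), abs_of_nonneg (pow_nonneg (norm_nonneg _) 3)]
    have hP := norm_nonneg (fderiv ℝ v x)
    have : ‖fderiv ℝ v x‖ ^ 3 ≤ B * ‖fderiv ℝ v x‖ ^ 2 := by nlinarith [hB x, sq_nonneg ‖fderiv ℝ v x‖]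
    calc deriv g (x 2) * ‖fderiv ℝ v x‖ ^ 3 ≤ K1 * (B * ‖fderiv ℝ v x‖ ^ 2) :=
          mul_le_mul ((le_abs_self _).trans (hK1 _)) this (by positivity) hK10
      _ = K1 * B * ‖fderiv ℝ v x‖ ^ 2 := by ring
  have hpt : ∀ x : EuclideanSpace ℝ (Fin 3), deriv g (x 2) * ‖fderiv ℝ v x‖ ^ 3 ≤ (1 / 2) * (lam * (deriv g (x 2) * frobeniusNormSq (fderiv ℝ v x)) + (1 / lam) * (deriv g (x 2) * frobeniusNormSq (fderiv ℝ v x) ^ 2)) := fun x => by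
    have y := cube_le_young (sq_opNorm_le_frobeniusNormSq (fderiv ℝ v x)) (norm_fderiv_pow_four_le_frobeniusNormSq_sq x) hlam
    have := mul_le_mul_of_nonneg_left y (hγ0 (x 2))
    linarith [this]
  have iR : Integrable (fun x : EuclideanSpace ℝ (Fin 3) => (1 / 2) * (lam * (deriv g (x 2) * frobeniusNormSq (fderiv ℝ v x)) + (1 / lam) * (deriv g (x 2) * frobeniusNormSq (fderiv ℝ v x) ^ 2))) volume :=
    ((iI1.const_mul lam).add (iFR4.const_mul (1 / lam))).const_mul (1 / 2)
  have hm := integral_mono iP3 iR hpt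
  rw [integral_const_mul, integral_add (iI1.const_mul lam) (iFR4.const_mul (1 / lam)), integral_const_mul, integral_const_mul] at hm
  exact hm

/-- **The quartic line**: `∫g′|Dv|⁴_F ≤ 4σB∫|g″||Dv|²_F + 108σ²Σₖ∫g′|D∂ₖv|²_F` (`‖v − c‖ ≤ σ` on `supp g′ ∪ supp g″`, `‖Dv‖ ≤ B`,
`D¹v, D²v ∈ L²`, `g′ ≥ 0`, `g′, g″` bounded). [folklore] -/
theorem integral_layerQuartic_le (hv : ContDiff ℝ ∞ v) {B K1 K2 σ : ℝ} (hB : ∀ x, ‖fderiv ℝ v x‖ ≤ B)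
    (hg : ContDiff ℝ ∞ g) (hγ0 : ∀ s, 0 ≤ deriv g s) (hK1 : ∀ s, |deriv g s| ≤ K1) (hK2 : ∀ s, |deriv (deriv g) s| ≤ K2)
    (hσ0 : 0 ≤ σ) (hσ1 : ∀ x : EuclideanSpace ℝ (Fin 3), deriv g (x 2) ≠ 0 → ‖v x - c‖ ≤ σ) (hσ2 : ∀ x : EuclideanSpace ℝ (Fin 3), deriv (deriv g) (x 2) ≠ 0 → ‖v x - c‖ ≤ σ)
    (h1 : ∫⁻ x, ‖iteratedFDeriv ℝ 1 v x‖ₑ ^ 2 < ⊤) (h2 : ∫⁻ x, ‖iteratedFDeriv ℝ 2 v x‖ₑ ^ 2 < ⊤) :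
    (∫ x : EuclideanSpace ℝ (Fin 3), deriv g (x 2) * frobeniusNormSq (fderiv ℝ v x) ^ 2) ≤ 4 * σ * B * (∫ x : EuclideanSpace ℝ (Fin 3), |deriv (deriv g) (x 2)| * frobeniusNormSq (fderiv ℝ v x)) + 108 * σ ^ 2 * (∫ x : EuclideanSpace ℝ (Fin 3), deriv g (x 2) * ∑ k : Fin 3, frobeniusNormSq (fderiv ℝ (fun z => fderiv ℝ v z (EuclideanSpace.basisFun (Fin 3) ℝ k)) x)) := by
  have lt2 : (2 : WithTop ℕ∞) ≤ ((⊤ : ℕ∞) : WithTop ℕ∞) := WithTop.coe_le_coe.mpr le_top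
  have hv2 : ContDiff ℝ 2 v := hv.of_le lt2
  have hK10 : 0 ≤ K1 := (abs_nonneg _).trans (hK1 0)
  obtain ⟨-, iP2⟩ := integrable_sq_curl_and_fderiv hv h1
  have iQ2 : Integrable (fun x : EuclideanSpace ℝ (Fin 3) => ‖iteratedFDeriv ℝ 2 v x‖ ^ 2) volume :=
    integrable_sq_norm_of_lintegral (hv.continuous_iteratedFDeriv (WithTop.coe_le_coe.mpr le_top)) h2
  have hg1 : ContDiff ℝ (⊤ : ℕ∞) (deriv g) := by simpa using hg.iterate_deriv 1
  have hg2 : ContDiff ℝ (⊤ : ℕ∞) (deriv (deriv g)) := by simpa using hg.iterate_deriv 2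
  have cg1 : Continuous fun x : EuclideanSpace ℝ (Fin 3) => deriv g (x 2) := hg1.continuous.comp (PiLp.continuous_apply 2 _ (2 : Fin 3))
  have cg2 : Continuous fun x : EuclideanSpace ℝ (Fin 3) => deriv (deriv g) (x 2) := hg2.continuous.comp (PiLp.continuous_apply 2 _ (2 : Fin 3))
  have cF : Continuous fun x : EuclideanSpace ℝ (Fin 3) => frobeniusNormSq (fderiv ℝ v x) := continuous_frobeniusNormSq_fderiv hv (by simp)
  have hF0 : ∀ L : EuclideanSpace ℝ (Fin 3) →L[ℝ] EuclideanSpace ℝ (Fin 3), 0 ≤ frobeniusNormSq L := fun L => frobeniusNormSq_nonneg _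
  have nb : ∀ k : Fin 3, ‖EuclideanSpace.basisFun (Fin 3) ℝ k‖ = 1 := fun k => (EuclideanSpace.basisFun (Fin 3) ℝ).orthonormal.norm_eq_one k
  have frob_le : ∀ x : EuclideanSpace ℝ (Fin 3), frobeniusNormSq (fderiv ℝ v x) ≤ 3 * ‖fderiv ℝ v x‖ ^ 2 := fun x => by
    rw [frobeniusNormSq_eq_sum (EuclideanSpace.basisFun (Fin 3) ℝ)]
    have := sum_sq_norm_apply_le_card_mul_sq_opNorm (EuclideanSpace.basisFun (Fin 3) ℝ) (fderiv ℝ v x)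
    rwa [Fintype.card_fin, Nat.cast_ofNat] at this
  -- the general interpolation for `V = v − c`
  have hVs : ContDiff ℝ ∞ (fun y => v y - c) := hv.sub contDiff_const
  have hB' : ∀ x, ‖fderiv ℝ (fun y => v y - c) x‖ ≤ B := fun x => by rw [fderiv_sub_const]; exact hB x
  have i1' : Integrable (fun y : EuclideanSpace ℝ (Fin 3) => ‖fderiv ℝ (fun y => v y - c) y‖ ^ 2) volume := by simp only [fderiv_sub_const]; exact iP2
  have i2' : Integrable (fun y : EuclideanSpace ℝ (Fin 3) => ‖iteratedFDeriv ℝ 2 (fun y => v y - c) y‖ ^ 2) volume := by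
    refine iQ2.congr (Eventually.of_forall fun x => ?_); simp only; rw [iteratedFDeriv_sub_const_of_ne hv c two_ne_zero]
  have hγK1 : ∀ s, deriv g s ≤ K1 := fun s => (le_abs_self _).trans (hK1 s)
  have hb4 := integral_axialWeight_frobeniusNormSq_sq_le_general (V := fun y => v y - c) (γ := deriv g) hVs (hg1.of_le (by exact_mod_cast le_top))
    hγ0 hγK1 hK2 hσ0 hσ1 hB' i1' i2'
  simp only [fderiv_sub_const] at hb4
  have eQ : (∫ x : EuclideanSpace ℝ (Fin 3), deriv g (x 2) * ‖iteratedFDeriv ℝ 2 (fun y => v y - c) x‖ ^ 2) = ∫ x : EuclideanSpace ℝ (Fin 3), deriv g (x 2) * ‖iteratedFDeriv ℝ 2 v x‖ ^ 2 :=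
    integral_congr_ae (Eventually.of_forall fun x => by simp only; rw [iteratedFDeriv_sub_const_of_ne hv c two_ne_zero])
  rw [eQ] at hb4
  -- the `|g″|`-term
  have hptB : ∀ x : EuclideanSpace ℝ (Fin 3), |deriv (deriv g) (x 2)| * (frobeniusNormSq (fderiv ℝ v x) * ∑ k : Fin 3, |⟪v x - c, fderiv ℝ v x (EuclideanSpace.basisFun (Fin 3) ℝ k)⟫|) ≤
      3 * σ * B * (|deriv (deriv g) (x 2)| * frobeniusNormSq (fderiv ℝ v x)) := fun x => by
    by_cases h0 : deriv (deriv g) (x 2) = 0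
    · rw [h0, abs_zero]; simp
    have hVσ := hσ2 x h0
    have hk : ∀ k : Fin 3, |⟪v x - c, fderiv ℝ v x (EuclideanSpace.basisFun (Fin 3) ℝ k)⟫| ≤ σ * B := fun k => by
      have nk : ‖fderiv ℝ v x (EuclideanSpace.basisFun (Fin 3) ℝ k)‖ ≤ ‖fderiv ℝ v x‖ := by simpa [nb k] using (fderiv ℝ v x).le_opNorm (EuclideanSpace.basisFun (Fin 3) ℝ k)
      exact (abs_real_inner_le_norm _ _).trans (mul_le_mul hVσ (nk.trans (hB x)) (norm_nonneg _) hσ0)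
    have hS : ∑ k : Fin 3, |⟪v x - c, fderiv ℝ v x (EuclideanSpace.basisFun (Fin 3) ℝ k)⟫| ≤ 3 * σ * B :=
      (Finset.sum_le_sum fun k _ => hk k).trans (by simp; ring_nf; rfl)
    have h1' := mul_le_mul_of_nonneg_left hS (mul_nonneg (abs_nonneg (deriv (deriv g) (x 2))) (hF0 (fderiv ℝ v x)))
    nlinarith [h1']
  have iJ2f : Integrable (fun x : EuclideanSpace ℝ (Fin 3) => |deriv (deriv g) (x 2)| * frobeniusNormSq (fderiv ℝ v x)) volume := by
    refine (iP2.const_mul (K2 * 3)).mono' ((continuous_abs.comp cg2).mul cF).aestronglyMeasurable (Eventually.of_forall fun x => ?_)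
    rw [Real.norm_eq_abs, abs_mul, abs_abs, abs_of_nonneg (hF0 _)]
    have hK20 : 0 ≤ K2 := (abs_nonneg _).trans (hK2 0)
    nlinarith [mul_le_mul (hK2 (x 2)) (frob_le x) (hF0 _) hK20]
  have cu : ∀ k : Fin 3, Continuous fun x : EuclideanSpace ℝ (Fin 3) => fderiv ℝ v x (EuclideanSpace.basisFun (Fin 3) ℝ k) := fun k => (hv.continuous_fderiv (by simp)).clm_apply continuous_const
  have iLB : Integrable (fun x : EuclideanSpace ℝ (Fin 3) => |deriv (deriv g) (x 2)| * (frobeniusNormSq (fderiv ℝ v x) * ∑ k : Fin 3, |⟪v x - c, fderiv ℝ v x (EuclideanSpace.basisFun (Fin 3) ℝ k)⟫|)) volume := by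
    refine (iJ2f.const_mul (3 * σ * B)).mono' ((continuous_abs.comp cg2).mul (cF.mul (continuous_finsetSum _ fun k _ =>
      ((hv.continuous.sub continuous_const).inner (cu k)).abs))).aestronglyMeasurable (Eventually.of_forall fun x => ?_)
    rw [Real.norm_eq_abs, abs_of_nonneg (mul_nonneg (abs_nonneg _) (mul_nonneg (hF0 _) (Finset.sum_nonneg fun k _ => abs_nonneg _)))]
    exact hptB x
  have hbJ : (∫ x : EuclideanSpace ℝ (Fin 3), |deriv (deriv g) (x 2)| * (frobeniusNormSq (fderiv ℝ v x) * ∑ k : Fin 3, |⟪v x - c, fderiv ℝ v x (EuclideanSpace.basisFun (Fin 3) ℝ k)⟫|)) ≤ 3 * σ * B * (∫ x : EuclideanSpace ℝ (Fin 3), |deriv (deriv g) (x 2)| * frobeniusNormSq (fderiv ℝ v x)) := by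
    rw [← integral_const_mul]; exact integral_mono iLB (iJ2f.const_mul _) hptB
  -- `∫g′‖D²v‖² ≤ F₂`
  have cFk : ∀ k : Fin 3, Continuous fun x : EuclideanSpace ℝ (Fin 3) => frobeniusNormSq (fderiv ℝ (fun z => fderiv ℝ v z (EuclideanSpace.basisFun (Fin 3) ℝ k)) x) := fun k =>
    continuous_frobeniusNormSq_fderiv ((hv.fderiv_right (m := ∞) (by exact_mod_cast le_rfl)).clm_apply contDiff_const) (by simp)
  have nDu : ∀ (k : Fin 3) (x : EuclideanSpace ℝ (Fin 3)), ‖fderiv ℝ (fun z => fderiv ℝ v z (EuclideanSpace.basisFun (Fin 3) ℝ k)) x‖ ≤ ‖iteratedFDeriv ℝ 2 v x‖ := fun k x => by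
    rw [fderiv_fderiv_apply_eq hv2 x]
    have e1 : ‖fderiv ℝ (fderiv ℝ v) x‖ = ‖iteratedFDeriv ℝ 2 v x‖ := by
      rw [← norm_iteratedFDeriv_zero (𝕜 := ℝ) (f := fderiv ℝ (fderiv ℝ v)), norm_iteratedFDeriv_fderiv, norm_iteratedFDeriv_fderiv]
    rw [← e1]; simpa [nb k] using (fderiv ℝ (fderiv ℝ v) x).le_opNorm (EuclideanSpace.basisFun (Fin 3) ℝ k)
  have iF2 : Integrable (fun x : EuclideanSpace ℝ (Fin 3) => deriv g (x 2) * ∑ k : Fin 3, frobeniusNormSq (fderiv ℝ (fun z => fderiv ℝ v z (EuclideanSpace.basisFun (Fin 3) ℝ k)) x)) volume := by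
    refine (iQ2.const_mul (K1 * 9)).mono' (cg1.mul (continuous_finsetSum _ fun k _ => cFk k)).aestronglyMeasurable (Eventually.of_forall fun x => ?_)
    rw [Real.norm_eq_abs, abs_mul, abs_of_nonneg (hγ0 _), abs_of_nonneg (Finset.sum_nonneg fun k _ => hF0 _)]
    have hk : ∀ k : Fin 3, frobeniusNormSq (fderiv ℝ (fun z => fderiv ℝ v z (EuclideanSpace.basisFun (Fin 3) ℝ k)) x) ≤ 3 * ‖iteratedFDeriv ℝ 2 v x‖ ^ 2 := fun k => by
      rw [frobeniusNormSq_eq_sum (EuclideanSpace.basisFun (Fin 3) ℝ)]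
      have := sum_sq_norm_apply_le_card_mul_sq_opNorm (EuclideanSpace.basisFun (Fin 3) ℝ) (fderiv ℝ (fun z => fderiv ℝ v z (EuclideanSpace.basisFun (Fin 3) ℝ k)) x)
      rw [Fintype.card_fin, Nat.cast_ofNat] at this
      exact this.trans (by nlinarith [nDu k x, norm_nonneg (fderiv ℝ (fun z => fderiv ℝ v z (EuclideanSpace.basisFun (Fin 3) ℝ k)) x)])
    calc deriv g (x 2) * ∑ k : Fin 3, frobeniusNormSq (fderiv ℝ (fun z => fderiv ℝ v z (EuclideanSpace.basisFun (Fin 3) ℝ k)) x) ≤ K1 * ∑ k : Fin 3, 3 * ‖iteratedFDeriv ℝ 2 v x‖ ^ 2 :=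
          mul_le_mul (hγK1 _) (Finset.sum_le_sum fun k _ => hk k) (Finset.sum_nonneg fun k _ => hF0 _) hK10
      _ = K1 * 9 * ‖iteratedFDeriv ℝ 2 v x‖ ^ 2 := by simp; ring
  have iQg : Integrable (fun x : EuclideanSpace ℝ (Fin 3) => deriv g (x 2) * ‖iteratedFDeriv ℝ 2 v x‖ ^ 2) volume := by
    refine (iQ2.const_mul K1).mono' (cg1.mul ((hv.continuous_iteratedFDeriv (m := 2) lt2).norm.pow 2)).aestronglyMeasurable
      (Eventually.of_forall fun x => ?_)
    rw [Real.norm_eq_abs, abs_mul, abs_of_nonneg (hγ0 _), abs_of_nonneg (sq_nonneg _)]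
    exact mul_le_mul_of_nonneg_right (hγK1 _) (sq_nonneg _)
  have hQF : (∫ x : EuclideanSpace ℝ (Fin 3), deriv g (x 2) * ‖iteratedFDeriv ℝ 2 v x‖ ^ 2) ≤ (∫ x : EuclideanSpace ℝ (Fin 3), deriv g (x 2) * ∑ k : Fin 3, frobeniusNormSq (fderiv ℝ (fun z => fderiv ℝ v z (EuclideanSpace.basisFun (Fin 3) ℝ k)) x)) :=
    integral_mono iQg iF2 fun x => mul_le_mul_of_nonneg_left (sq_norm_iteratedFDeriv_two_le_sum_frobeniusNormSq hv2 x) (hγ0 _)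
  have hσ2' : 0 ≤ 108 * σ ^ 2 := by positivity
  nlinarith [hb4, hbJ, mul_le_mul_of_nonneg_left hQF hσ2']

/-- **The layer inequality in closed form** (notation of the file header). [folklore] -/
theorem slideLayerInequality_closed
    (hv : ContDiff ℝ ∞ v) (hdiv : VectorCalculus.IsDivFree v) {M B : ℝ} (hMpos : 0 < M)
    (hM : ∀ x, ‖v x‖ = M) (hB : ∀ x, ‖fderiv ℝ v x‖ ≤ B)
    (h1 : ∫⁻ x, ‖iteratedFDeriv ℝ 1 v x‖ₑ ^ 2 < ⊤) (h2 : ∫⁻ x, ‖iteratedFDeriv ℝ 2 v x‖ₑ ^ 2 < ⊤)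
    (hatt : |∫ x, ⟪curl v x, fderiv ℝ v x (curl v x)⟫| = (sInf {κ : ℝ | (∀ (v : EuclideanSpace ℝ (Fin 3) → EuclideanSpace ℝ (Fin 3)) (M B : ℝ), ContDiff ℝ (⊤ : ℕ∞) v → Literature.Analysis.FluidPDE.VectorCalculus.IsDivFree v → (∀ x, ‖v x‖ ≤ M) → (∀ x, ‖fderiv ℝ v x‖ ≤ B) → (∫⁻ x, ‖iteratedFDeriv ℝ 0 v x‖ₑ ^ 2 < ⊤) → (∫⁻ x, ‖iteratedFDeriv ℝ 1 v x‖ₑ ^ 2 < ⊤) → (∫⁻ x, ‖iteratedFDeriv ℝ 2 v x‖ₑ ^ 2 < ⊤) → |∫ x, ⟪Literature.Analysis.FluidPDE.curl v x, fderiv ℝ v x (Literature.Analysis.FluidPDE.curl v x)⟫_ℝ| ≤ κ * M * Real.sqrt (∫ x, ‖Literature.Analysis.FluidPDE.curl v x‖ ^ 2) * Real.sqrt (∫ x, Literature.Analysis.FluidPDE.frobeniusNormSq (fderiv ℝ (Literature.Analysis.FluidPDE.curl v) x)))}) * M * Real.sqrt (∫ x, ‖curl v x‖ ^ 2) * Real.sqrt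 (∫ x, frobeniusNormSq (fderiv ℝ (curl v) x)))
    (hc0 : c 0 = 0) (hc1 : c 1 = 0) (hcM : ‖c‖ = M)
    (hg : ContDiff ℝ ∞ g) {T K0 K1 K2 K3 : ℝ} (hT : 0 < T)
    (hK0 : ∀ s, |g s| ≤ K0) (hK1 : ∀ s, |deriv g s| ≤ K1) (hK2 : ∀ s, |deriv (deriv g) s| ≤ K2)
    (hK3 : ∀ s, |deriv (deriv (deriv g)) s| ≤ K3)
    (hT1 : ∀ s, T ≤ |s| → deriv g s = 0) (hT2 : ∀ s, T ≤ |s| → deriv (deriv g) s = 0)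
    (hT3 : ∀ s, T ≤ |s| → deriv (deriv (deriv g)) s = 0)
    (hg0 : ∀ s, 0 ≤ g s) (hγ0 : ∀ s, 0 ≤ deriv g s)
    (hslab : Integrable (fun x => {x : EuclideanSpace ℝ (Fin 3) | |x 2| ≤ T}.indicator (fun x => ‖v x - c‖ ^ 2) x) volume)
    {h₀ : ℝ} (hh₀ : 0 < h₀) (hfar : ∀ x : EuclideanSpace ℝ (Fin 3), |x 2| ≤ T + h₀ → ‖v x - c‖ ^ 2 ≤ 2 * M ^ 2)
    {σ : ℝ} (hσ0 : 0 ≤ σ) (hσM : 10 * σ ≤ M)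
    (hσ1 : ∀ x : EuclideanSpace ℝ (Fin 3), deriv g (x 2) ≠ 0 → ‖v x - c‖ ≤ σ) (hσ2 : ∀ x : EuclideanSpace ℝ (Fin 3), deriv (deriv g) (x 2) ≠ 0 → ‖v x - c‖ ≤ σ)
    {lam : ℝ} (hlam : 0 < lam) :
    ((sInf {κ : ℝ | (∀ (v : EuclideanSpace ℝ (Fin 3) → EuclideanSpace ℝ (Fin 3)) (M B : ℝ), ContDiff ℝ (⊤ : ℕ∞) v → Literature.Analysis.FluidPDE.VectorCalculus.IsDivFree v → (∀ x, ‖v x‖ ≤ M) → (∀ x, ‖fderiv ℝ v x‖ ≤ B) → (∫⁻ x, ‖iteratedFDeriv ℝ 0 v x‖ₑ ^ 2 < ⊤) → (∫⁻ x, ‖iteratedFDeriv ℝ 1 v x‖ₑ ^ 2 < ⊤) → (∫⁻ x, ‖iteratedFDeriv ℝ 2 v x‖ₑ ^ 2 < ⊤) → |∫ x, ⟪Literature.Analysis.FluidPDE.curl v x, fderiv ℝ v x (Literature.Analysis.FluidPDE.curl v x)⟫_ℝ| ≤ κ * M * Real.sqrt (∫ x, ‖Literature.Analysis.FluidPDE.curl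 v x‖ ^ 2) * Real.sqrt (∫ x, Literature.Analysis.FluidPDE.frobeniusNormSq (fderiv ℝ (Literature.Analysis.FluidPDE.curl v) x)))})) ^ 2 * M ^ 2 / 4 * ((∫ x, frobeniusNormSq (fderiv ℝ (curl v) x)) * (∫ x : EuclideanSpace ℝ (Fin 3), deriv g (x 2) * frobeniusNormSq (fderiv ℝ v x)) + (∫ x, ‖curl v x‖ ^ 2) * (∫ x : EuclideanSpace ℝ (Fin 3), deriv g (x 2) * ∑ k : Fin 3, frobeniusNormSq (fderiv ℝ (fun z => fderiv ℝ v z (EuclideanSpace.basisFun (Fin 3) ℝ k)) x))) ≤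
      64 * lam * |(∫ x, ⟪curl v x, fderiv ℝ v x (curl v x)⟫)| * (∫ x : EuclideanSpace ℝ (Fin 3), deriv g (x 2) * frobeniusNormSq (fderiv ℝ v x)) +
        (64 * |(∫ x, ⟪curl v x, fderiv ℝ v x (curl v x)⟫)| / lam + 2 * ((sInf {κ : ℝ | (∀ (v : EuclideanSpace ℝ (Fin 3) → EuclideanSpace ℝ (Fin 3)) (M B : ℝ), ContDiff ℝ (⊤ : ℕ∞) v → Literature.Analysis.FluidPDE.VectorCalculus.IsDivFree v → (∀ x, ‖v x‖ ≤ M) → (∀ x, ‖fderiv ℝ v x‖ ≤ B) → (∫⁻ x, ‖iteratedFDeriv ℝ 0 v x‖ₑ ^ 2 < ⊤) → (∫⁻ x, ‖iteratedFDeriv ℝ 1 v x‖ₑ ^ 2 < ⊤) → (∫⁻ x, ‖iteratedFDeriv ℝ 2 v x‖ₑ ^ 2 < ⊤) → |∫ x, ⟪Literature.Analysis.FluidPDE.curl v x, fderiv ℝ v x (Literature.Analysis.FluidPDE.curl v x)⟫_ℝ| ≤ κ * M * Real.sqrt (∫ x, ‖Literature.Analysis.FluidPDE.curl v x‖ ^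 2) * Real.sqrt (∫ x, Literature.Analysis.FluidPDE.frobeniusNormSq (fderiv ℝ (Literature.Analysis.FluidPDE.curl v) x)))})) ^ 2 * (∫ x, ‖curl v x‖ ^ 2)) * (4 * σ * B * (∫ x : EuclideanSpace ℝ (Fin 3), |deriv (deriv g) (x 2)| * frobeniusNormSq (fderiv ℝ v x)) + 108 * σ ^ 2 * (∫ x : EuclideanSpace ℝ (Fin 3), deriv g (x 2) * ∑ k : Fin 3, frobeniusNormSq (fderiv ℝ (fun z => fderiv ℝ v z (EuclideanSpace.basisFun (Fin 3) ℝ k)) x))) +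
        40 * σ * |(∫ x, ⟪curl v x, fderiv ℝ v x (curl v x)⟫)| * (∫ x : EuclideanSpace ℝ (Fin 3), |deriv (deriv g) (x 2)| * frobeniusNormSq (fderiv ℝ v x)) +
        ((sInf {κ : ℝ | (∀ (v : EuclideanSpace ℝ (Fin 3) → EuclideanSpace ℝ (Fin 3)) (M B : ℝ), ContDiff ℝ (⊤ : ℕ∞) v → Literature.Analysis.FluidPDE.VectorCalculus.IsDivFree v → (∀ x, ‖v x‖ ≤ M) → (∀ x, ‖fderiv ℝ v x‖ ≤ B) → (∫⁻ x, ‖iteratedFDeriv ℝ 0 v x‖ₑ ^ 2 < ⊤) → (∫⁻ x, ‖iteratedFDeriv ℝ 1 v x‖ₑ ^ 2 < ⊤) → (∫⁻ x, ‖iteratedFDeriv ℝ 2 v x‖ₑ ^ 2 < ⊤) → |∫ x, ⟪Literature.Analysis.FluidPDE.curl v x, fderiv ℝ v x (Literature.Analysis.FluidPDE.curl v x)⟫_ℝ| ≤ κ * M * Real.sqrt (∫ x, ‖Literature.Analysis.FluidPDE.curl v x‖ ^ 2) * Real.sqrt (∫ x, Literature.Analysis.FluidPDE.frobeniusNormSq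 (fderiv ℝ (Literature.Analysis.FluidPDE.curl v) x)))})) ^ 2 * (∫ x, ‖curl v x‖ ^ 2) * (M ^ 2 * ((1 / 2) * |(∫ x : EuclideanSpace ℝ (Fin 3), deriv (deriv (deriv g)) (x 2) * ∑ k : Fin 3, (fderiv ℝ v x (EuclideanSpace.basisFun (Fin 3) ℝ k) 2) ^ 2)| + (1 / 2) * |(∫ x : EuclideanSpace ℝ (Fin 3), deriv (deriv (deriv g)) (x 2) * ‖curl v x‖ ^ 2)| + |(∫ x : EuclideanSpace ℝ (Fin 3), deriv (deriv (deriv g)) (x 2) * (fderiv ℝ v x (EuclideanSpace.single (2 : Fin 3) (1 : ℝ)) 2) ^ 2)| +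
        |(∫ x : EuclideanSpace ℝ (Fin 3), deriv (deriv (deriv g)) (x 2) * ⟪fderiv ℝ (curl v) x (EuclideanSpace.single (2 : Fin 3) (1 : ℝ)),
          (-(v x - c) 1) • EuclideanSpace.single (0 : Fin 3) (1 : ℝ) + ((v x - c) 0) • EuclideanSpace.single (1 : Fin 3) (1 : ℝ)⟫)| +
        |(∫ x : EuclideanSpace ℝ (Fin 3), deriv (deriv g) (x 2) * ⟪fderiv ℝ (curl v) x (EuclideanSpace.single (2 : Fin 3) (1 : ℝ)),
          fderiv ℝ (fun z : EuclideanSpace ℝ (Fin 3) => (-(v z - c) 1) • EuclideanSpace.single (0 : Fin 3) (1 : ℝ) + ((v z - c) 0) • EuclideanSpace.single (1 : Fin 3) (1 : ℝ)) x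
            (EuclideanSpace.single (2 : Fin 3) (1 : ℝ))⟫)| +
        |(∫ x : EuclideanSpace ℝ (Fin 3), ∑ i : Fin 3, deriv (deriv g) (x 2) * ⟪fderiv ℝ (curl v) x (EuclideanSpace.basisFun (Fin 3) ℝ i),
            fderiv ℝ (fun z : EuclideanSpace ℝ (Fin 3) => (-(v z - c) 1) • EuclideanSpace.single (0 : Fin 3) (1 : ℝ) + ((v z - c) 0) • EuclideanSpace.single (1 : Fin 3) (1 : ℝ)) x
              (EuclideanSpace.basisFun (Fin 3) ℝ i)⟫)| +
        |(∫ x : EuclideanSpace ℝ (Fin 3), deriv (deriv g) (x 2) * (fderiv ℝ (curl v) x (EuclideanSpace.single (2 : Fin 3) (1 : ℝ)) 0 * fderiv ℝ v x (EuclideanSpace.single (1 : Fin 3) (1 : ℝ)) 2 -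
          fderiv ℝ (curl v) x (EuclideanSpace.single (2 : Fin 3) (1 : ℝ)) 1 * fderiv ℝ v x (EuclideanSpace.single (0 : Fin 3) (1 : ℝ)) 2))|)) := by
  have hL := slideLayerInequality hv hdiv hMpos hM hB h1 h2 hatt hc0 hc1 hcM hg hT hK0 hK1 hK2 hK3 hT1 hT2 hT3 hg0 hγ0 hslab hh₀ hfar
    hσ0 hσM hσ1 hσ2
  have hg1 : ContDiff ℝ (⊤ : ℕ∞) (deriv g) := by simpa using hg.iterate_deriv 1
  have ha := integral_layerCubic_le (g := g) hv hB (hg1.of_le (by exact_mod_cast le_top)) hγ0 hK1 h1 hlam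
  have hb := integral_layerQuartic_le (c := c) hv hB hg hγ0 hK1 hK2 hσ0 hσ1 hσ2 h1 h2
  -- `∫|g″|‖Dv‖² ≤ ∫|g″||Dv|²_F`
  obtain ⟨-, iP2⟩ := integrable_sq_curl_and_fderiv hv h1
  have hg2 : ContDiff ℝ (⊤ : ℕ∞) (deriv (deriv g)) := by simpa using hg.iterate_deriv 2
  have cg2 : Continuous fun x : EuclideanSpace ℝ (Fin 3) => deriv (deriv g) (x 2) := hg2.continuous.comp (PiLp.continuous_apply 2 _ (2 : Fin 3))
  have cF : Continuous fun x : EuclideanSpace ℝ (Fin 3) => frobeniusNormSq (fderiv ℝ v x) := continuous_frobeniusNormSq_fderiv hv (by simp)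
  have cP : Continuous fun x : EuclideanSpace ℝ (Fin 3) => ‖fderiv ℝ v x‖ := (hv.continuous_fderiv (by simp)).norm
  have hK20 : 0 ≤ K2 := (abs_nonneg _).trans (hK2 0)
  have frob_le : ∀ x : EuclideanSpace ℝ (Fin 3), frobeniusNormSq (fderiv ℝ v x) ≤ 3 * ‖fderiv ℝ v x‖ ^ 2 := fun x => by
    rw [frobeniusNormSq_eq_sum (EuclideanSpace.basisFun (Fin 3) ℝ)]
    have := sum_sq_norm_apply_le_card_mul_sq_opNorm (EuclideanSpace.basisFun (Fin 3) ℝ) (fderiv ℝ v x)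
    rwa [Fintype.card_fin, Nat.cast_ofNat] at this
  have iJ2f : Integrable (fun x : EuclideanSpace ℝ (Fin 3) => |deriv (deriv g) (x 2)| * frobeniusNormSq (fderiv ℝ v x)) volume := by
    refine (iP2.const_mul (K2 * 3)).mono' ((continuous_abs.comp cg2).mul cF).aestronglyMeasurable (Eventually.of_forall fun x => ?_)
    rw [Real.norm_eq_abs, abs_mul, abs_abs, abs_of_nonneg (frobeniusNormSq_nonneg _)]
    nlinarith [mul_le_mul (hK2 (x 2)) (frob_le x) (frobeniusNormSq_nonneg _) hK20]
  have iJ2 : Integrable (fun x : EuclideanSpace ℝ (Fin 3) => |deriv (deriv g) (x 2)| * ‖fderiv ℝ v x‖ ^ 2) volume := by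
    refine (iP2.const_mul K2).mono' ((continuous_abs.comp cg2).mul (cP.pow 2)).aestronglyMeasurable (Eventually.of_forall fun x => ?_)
    rw [Real.norm_eq_abs, abs_mul, abs_abs, abs_of_nonneg (sq_nonneg ‖fderiv ℝ v x‖)]
    exact mul_le_mul_of_nonneg_right (hK2 _) (sq_nonneg _)
  have hc : (∫ x : EuclideanSpace ℝ (Fin 3), |deriv (deriv g) (x 2)| * ‖fderiv ℝ v x‖ ^ 2) ≤ (∫ x : EuclideanSpace ℝ (Fin 3), |deriv (deriv g) (x 2)| * frobeniusNormSq (fderiv ℝ v x)) := integral_mono iJ2 iJ2f fun x => mul_le_mul_of_nonneg_left (sq_opNorm_le_frobeniusNormSq _) (abs_nonneg _)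
  -- assemble
  have hS0 : 0 ≤ |(∫ x, ⟪curl v x, fderiv ℝ v x (curl v x)⟫)| := abs_nonneg _
  have hκ : 0 ≤ ((sInf {κ : ℝ | (∀ (v : EuclideanSpace ℝ (Fin 3) → EuclideanSpace ℝ (Fin 3)) (M B : ℝ), ContDiff ℝ (⊤ : ℕ∞) v → Literature.Analysis.FluidPDE.VectorCalculus.IsDivFree v → (∀ x, ‖v x‖ ≤ M) → (∀ x, ‖fderiv ℝ v x‖ ≤ B) → (∫⁻ x, ‖iteratedFDeriv ℝ 0 v x‖ₑ ^ 2 < ⊤) → (∫⁻ x, ‖iteratedFDeriv ℝ 1 v x‖ₑ ^ 2 < ⊤) → (∫⁻ x, ‖iteratedFDeriv ℝ 2 v x‖ₑ ^ 2 < ⊤) → |∫ x, ⟪Literature.Analysis.FluidPDE.curl v x, fderiv ℝ v x (Literature.Analysis.FluidPDE.curl v x)⟫_ℝ| ≤ κ * M * Real.sqrt (∫ x, ‖Literature.Analysis.FluidPDE.curl v x‖ ^ 2) * Real.sqrt (∫ x, Literature.Analysis.FluidPDE.frobeniusNormSq (fderiv ℝ (Literature.Analysis.FluidPDE.curl v)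 x)))})) ^ 2 := sq_nonneg _
  have hEns : 0 ≤ (∫ x, ‖curl v x‖ ^ 2) := integral_nonneg fun x => sq_nonneg _
  have t1 : |(∫ x, ⟪curl v x, fderiv ℝ v x (curl v x)⟫)| * (128 * (∫ x : EuclideanSpace ℝ (Fin 3), deriv g (x 2) * ‖fderiv ℝ v x‖ ^ 3)) ≤ |(∫ x, ⟪curl v x, fderiv ℝ v x (curl v x)⟫)| * (64 * (lam * (∫ x : EuclideanSpace ℝ (Fin 3), deriv g (x 2) * frobeniusNormSq (fderiv ℝ v x)) + (1 / lam) * (∫ x : EuclideanSpace ℝ (Fin 3), deriv g (x 2) * frobeniusNormSq (fderiv ℝ v x) ^ 2))) := mul_le_mul_of_nonneg_left (by linarith [ha]) hS0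
  have t2 : |(∫ x, ⟪curl v x, fderiv ℝ v x (curl v x)⟫)| * (40 * σ * (∫ x : EuclideanSpace ℝ (Fin 3), |deriv (deriv g) (x 2)| * ‖fderiv ℝ v x‖ ^ 2)) ≤ |(∫ x, ⟪curl v x, fderiv ℝ v x (curl v x)⟫)| * (40 * σ * (∫ x : EuclideanSpace ℝ (Fin 3), |deriv (deriv g) (x 2)| * frobeniusNormSq (fderiv ℝ v x))) :=
    mul_le_mul_of_nonneg_left (mul_le_mul_of_nonneg_left hc (by positivity)) hS0
  have t3 : (64 * |(∫ x, ⟪curl v x, fderiv ℝ v x (curl v x)⟫)| / lam + 2 * ((sInf {κ : ℝ | (∀ (v : EuclideanSpace ℝ (Fin 3) → EuclideanSpace ℝ (Fin 3)) (M B : ℝ), ContDiff ℝ (⊤ : ℕ∞) v → Literature.Analysis.FluidPDE.VectorCalculus.IsDivFree v → (∀ x, ‖v x‖ ≤ M) → (∀ x, ‖fderiv ℝ v x‖ ≤ B) → (∫⁻ x, ‖iteratedFDeriv ℝ 0 v x‖ₑ ^ 2 < ⊤) → (∫⁻ x, ‖iteratedFDeriv ℝ 1 v x‖ₑ ^ 2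 < ⊤) → (∫⁻ x, ‖iteratedFDeriv ℝ 2 v x‖ₑ ^ 2 < ⊤) → |∫ x, ⟪Literature.Analysis.FluidPDE.curl v x, fderiv ℝ v x (Literature.Analysis.FluidPDE.curl v x)⟫_ℝ| ≤ κ * M * Real.sqrt (∫ x, ‖Literature.Analysis.FluidPDE.curl v x‖ ^ 2) * Real.sqrt (∫ x, Literature.Analysis.FluidPDE.frobeniusNormSq (fderiv ℝ (Literature.Analysis.FluidPDE.curl v) x)))})) ^ 2 * (∫ x, ‖curl v x‖ ^ 2)) * (∫ x : EuclideanSpace ℝ (Fin 3), deriv g (x 2) * frobeniusNormSq (fderiv ℝ v x) ^ 2) ≤ (64 * |(∫ x, ⟪curl v x, fderiv ℝ v x (curl v x)⟫)| / lam + 2 * ((sInf {κ : ℝ | (∀ (v : EuclideanSpace ℝ (Fin 3) → EuclideanSpace ℝ (Fin 3)) (M B : ℝ), ContDiff ℝ (⊤ : ℕ∞) v → Literature.Analysis.FluidPDE.VectorCalculus.IsDivFree v → (∀ x, ‖v x‖ ≤ M) → (∀ x, ‖fderiv ℝ v x‖ ≤ B) → (∫⁻ x, ‖iteratedFDeriv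 ℝ 0 v x‖ₑ ^ 2 < ⊤) → (∫⁻ x, ‖iteratedFDeriv ℝ 1 v x‖ₑ ^ 2 < ⊤) → (∫⁻ x, ‖iteratedFDeriv ℝ 2 v x‖ₑ ^ 2 < ⊤) → |∫ x, ⟪Literature.Analysis.FluidPDE.curl v x, fderiv ℝ v x (Literature.Analysis.FluidPDE.curl v x)⟫_ℝ| ≤ κ * M * Real.sqrt (∫ x, ‖Literature.Analysis.FluidPDE.curl v x‖ ^ 2) * Real.sqrt (∫ x, Literature.Analysis.FluidPDE.frobeniusNormSq (fderiv ℝ (Literature.Analysis.FluidPDE.curl v) x)))})) ^ 2 * (∫ x, ‖curl v x‖ ^ 2)) * (4 * σ * B * (∫ x : EuclideanSpace ℝ (Fin 3), |deriv (deriv g) (x 2)| * frobeniusNormSq (fderiv ℝ v x)) + 108 * σ ^ 2 * (∫ x : EuclideanSpace ℝ (Fin 3), deriv g (x 2) * ∑ k : Fin 3, frobeniusNormSq (fderiv ℝ (fun z => fderiv ℝ v z (EuclideanSpace.basisFun (Fin 3) ℝ k)) x))) :=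
    mul_le_mul_of_nonneg_left hb (add_nonneg (div_nonneg (mul_nonneg (by norm_num) hS0) hlam.le) (mul_nonneg (mul_nonneg (by norm_num) hκ) hEns))
  have e1 : |(∫ x, ⟪curl v x, fderiv ℝ v x (curl v x)⟫)| * (64 * (lam * (∫ x : EuclideanSpace ℝ (Fin 3), deriv g (x 2) * frobeniusNormSq (fderiv ℝ v x)) + (1 / lam) * (∫ x : EuclideanSpace ℝ (Fin 3), deriv g (x 2) * frobeniusNormSq (fderiv ℝ v x) ^ 2))) = 64 * lam * |(∫ x, ⟪curl v x, fderiv ℝ v x (curl v x)⟫)| * (∫ x : EuclideanSpace ℝ (Fin 3), deriv g (x 2) * frobeniusNormSq (fderiv ℝ v x)) + (64 * |(∫ x, ⟪curl v x, fderiv ℝ v x (curl v x)⟫)| / lam) * (∫ x : EuclideanSpace ℝ (Fin 3), deriv g (x 2) * frobeniusNormSq (fderiv ℝ v x) ^ 2) := by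
    ring
  have e2 : ((sInf {κ : ℝ | (∀ (v : EuclideanSpace ℝ (Fin 3) → EuclideanSpace ℝ (Fin 3)) (M B : ℝ), ContDiff ℝ (⊤ : ℕ∞) v → Literature.Analysis.FluidPDE.VectorCalculus.IsDivFree v → (∀ x, ‖v x‖ ≤ M) → (∀ x, ‖fderiv ℝ v x‖ ≤ B) → (∫⁻ x, ‖iteratedFDeriv ℝ 0 v x‖ₑ ^ 2 < ⊤) → (∫⁻ x, ‖iteratedFDeriv ℝ 1 v x‖ₑ ^ 2 < ⊤) → (∫⁻ x, ‖iteratedFDeriv ℝ 2 v x‖ₑ ^ 2 < ⊤) → |∫ x, ⟪Literature.Analysis.FluidPDE.curl v x, fderiv ℝ v x (Literature.Analysis.FluidPDE.curl v x)⟫_ℝ| ≤ κ * M * Real.sqrt (∫ x, ‖Literature.Analysis.FluidPDE.curl v x‖ ^ 2) * Real.sqrt (∫ x, Literature.Analysis.FluidPDE.frobeniusNormSq (fderiv ℝ (Literature.Analysis.FluidPDE.curl v) x)))})) ^ 2 * (∫ x, ‖curl v x‖ ^ 2) * (2 * (∫ x : EuclideanSpace ℝ (Fin 3), deriv g (x 2)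 * frobeniusNormSq (fderiv ℝ v x) ^ 2) + M ^ 2 * ((1 / 2) * |(∫ x : EuclideanSpace ℝ (Fin 3), deriv (deriv (deriv g)) (x 2) * ∑ k : Fin 3, (fderiv ℝ v x (EuclideanSpace.basisFun (Fin 3) ℝ k) 2) ^ 2)| + (1 / 2) * |(∫ x : EuclideanSpace ℝ (Fin 3), deriv (deriv (deriv g)) (x 2) * ‖curl v x‖ ^ 2)| + |(∫ x : EuclideanSpace ℝ (Fin 3), deriv (deriv (deriv g)) (x 2) * (fderiv ℝ v x (EuclideanSpace.single (2 : Fin 3) (1 : ℝ)) 2) ^ 2)| +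
        |(∫ x : EuclideanSpace ℝ (Fin 3), deriv (deriv (deriv g)) (x 2) * ⟪fderiv ℝ (curl v) x (EuclideanSpace.single (2 : Fin 3) (1 : ℝ)),
          (-(v x - c) 1) • EuclideanSpace.single (0 : Fin 3) (1 : ℝ) + ((v x - c) 0) • EuclideanSpace.single (1 : Fin 3) (1 : ℝ)⟫)| +
        |(∫ x : EuclideanSpace ℝ (Fin 3), deriv (deriv g) (x 2) * ⟪fderiv ℝ (curl v) x (EuclideanSpace.single (2 : Fin 3) (1 : ℝ)),
          fderiv ℝ (fun z : EuclideanSpace ℝ (Fin 3) => (-(v z - c) 1) • EuclideanSpace.single (0 : Fin 3) (1 : ℝ) + ((v z - c) 0) • EuclideanSpace.single (1 : Fin 3) (1 : ℝ)) x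
            (EuclideanSpace.single (2 : Fin 3) (1 : ℝ))⟫)| +
        |(∫ x : EuclideanSpace ℝ (Fin 3), ∑ i : Fin 3, deriv (deriv g) (x 2) * ⟪fderiv ℝ (curl v) x (EuclideanSpace.basisFun (Fin 3) ℝ i),
            fderiv ℝ (fun z : EuclideanSpace ℝ (Fin 3) => (-(v z - c) 1) • EuclideanSpace.single (0 : Fin 3) (1 : ℝ) + ((v z - c) 0) • EuclideanSpace.single (1 : Fin 3) (1 : ℝ)) x
              (EuclideanSpace.basisFun (Fin 3) ℝ i)⟫)| +
        |(∫ x : EuclideanSpace ℝ (Fin 3), deriv (deriv g) (x 2) * (fderiv ℝ (curl v) x (EuclideanSpace.single (2 : Fin 3) (1 : ℝ)) 0 * fderiv ℝ v x (EuclideanSpace.single (1 : Fin 3) (1 : ℝ)) 2 -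
          fderiv ℝ (curl v) x (EuclideanSpace.single (2 : Fin 3) (1 : ℝ)) 1 * fderiv ℝ v x (EuclideanSpace.single (0 : Fin 3) (1 : ℝ)) 2))|)) = (2 * ((sInf {κ : ℝ | (∀ (v : EuclideanSpace ℝ (Fin 3) → EuclideanSpace ℝ (Fin 3)) (M B : ℝ), ContDiff ℝ (⊤ : ℕ∞) v → Literature.Analysis.FluidPDE.VectorCalculus.IsDivFree v → (∀ x, ‖v x‖ ≤ M) → (∀ x, ‖fderiv ℝ v x‖ ≤ B) → (∫⁻ x, ‖iteratedFDeriv ℝ 0 v x‖ₑ ^ 2 < ⊤) → (∫⁻ x, ‖iteratedFDeriv ℝ 1 v x‖ₑ ^ 2 < ⊤) → (∫⁻ x, ‖iteratedFDeriv ℝ 2 v x‖ₑ ^ 2 < ⊤) → |∫ x, ⟪Literature.Analysis.FluidPDE.curl v x, fderiv ℝ v x (Literature.Analysis.FluidPDE.curl v x)⟫_ℝ| ≤ κ * M * Real.sqrt (∫ x, ‖Literature.Analysis.FluidPDE.curl v x‖ ^ 2) * Real.sqrt (∫ x, Literature.Analysis.FluidPDE.frobeniusNormSq (fderiv ℝ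 (Literature.Analysis.FluidPDE.curl v) x)))})) ^ 2 * (∫ x, ‖curl v x‖ ^ 2)) * (∫ x : EuclideanSpace ℝ (Fin 3), deriv g (x 2) * frobeniusNormSq (fderiv ℝ v x) ^ 2) + ((sInf {κ : ℝ | (∀ (v : EuclideanSpace ℝ (Fin 3) → EuclideanSpace ℝ (Fin 3)) (M B : ℝ), ContDiff ℝ (⊤ : ℕ∞) v → Literature.Analysis.FluidPDE.VectorCalculus.IsDivFree v → (∀ x, ‖v x‖ ≤ M) → (∀ x, ‖fderiv ℝ v x‖ ≤ B) → (∫⁻ x, ‖iteratedFDeriv ℝ 0 v x‖ₑ ^ 2 < ⊤) → (∫⁻ x, ‖iteratedFDeriv ℝ 1 v x‖ₑ ^ 2 < ⊤) → (∫⁻ x, ‖iteratedFDeriv ℝ 2 v x‖ₑ ^ 2 < ⊤) → |∫ x, ⟪Literature.Analysis.FluidPDE.curl v x, fderiv ℝ v x (Literature.Analysis.FluidPDE.curl v x)⟫_ℝ| ≤ κ * M * Real.sqrt (∫ x, ‖Literature.Analysis.FluidPDE.curl v x‖ ^ 2) * Real.sqrt (∫ x, Literature.Analysis.FluidPDE.frobeniusNormSq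 (fderiv ℝ (Literature.Analysis.FluidPDE.curl v) x)))})) ^ 2 * (∫ x, ‖curl v x‖ ^ 2) * (M ^ 2 * ((1 / 2) * |(∫ x : EuclideanSpace ℝ (Fin 3), deriv (deriv (deriv g)) (x 2) * ∑ k : Fin 3, (fderiv ℝ v x (EuclideanSpace.basisFun (Fin 3) ℝ k) 2) ^ 2)| + (1 / 2) * |(∫ x : EuclideanSpace ℝ (Fin 3), deriv (deriv (deriv g)) (x 2) * ‖curl v x‖ ^ 2)| + |(∫ x : EuclideanSpace ℝ (Fin 3), deriv (deriv (deriv g)) (x 2) * (fderiv ℝ v x (EuclideanSpace.single (2 : Fin 3) (1 : ℝ)) 2) ^ 2)| +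
        |(∫ x : EuclideanSpace ℝ (Fin 3), deriv (deriv (deriv g)) (x 2) * ⟪fderiv ℝ (curl v) x (EuclideanSpace.single (2 : Fin 3) (1 : ℝ)),
          (-(v x - c) 1) • EuclideanSpace.single (0 : Fin 3) (1 : ℝ) + ((v x - c) 0) • EuclideanSpace.single (1 : Fin 3) (1 : ℝ)⟫)| +
        |(∫ x : EuclideanSpace ℝ (Fin 3), deriv (deriv g) (x 2) * ⟪fderiv ℝ (curl v) x (EuclideanSpace.single (2 : Fin 3) (1 : ℝ)),
          fderiv ℝ (fun z : EuclideanSpace ℝ (Fin 3) => (-(v z - c) 1) • EuclideanSpace.single (0 : Fin 3) (1 : ℝ) + ((v z - c) 0) • EuclideanSpace.single (1 : Fin 3) (1 : ℝ)) x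
            (EuclideanSpace.single (2 : Fin 3) (1 : ℝ))⟫)| +
        |(∫ x : EuclideanSpace ℝ (Fin 3), ∑ i : Fin 3, deriv (deriv g) (x 2) * ⟪fderiv ℝ (curl v) x (EuclideanSpace.basisFun (Fin 3) ℝ i),
            fderiv ℝ (fun z : EuclideanSpace ℝ (Fin 3) => (-(v z - c) 1) • EuclideanSpace.single (0 : Fin 3) (1 : ℝ) + ((v z - c) 0) • EuclideanSpace.single (1 : Fin 3) (1 : ℝ)) x
              (EuclideanSpace.basisFun (Fin 3) ℝ i)⟫)| +
        |(∫ x : EuclideanSpace ℝ (Fin 3), deriv (deriv g) (x 2) * (fderiv ℝ (curl v) x (EuclideanSpace.single (2 : Fin 3) (1 : ℝ)) 0 * fderiv ℝ v x (EuclideanSpace.single (1 : Fin 3) (1 : ℝ)) 2 -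
          fderiv ℝ (curl v) x (EuclideanSpace.single (2 : Fin 3) (1 : ℝ)) 1 * fderiv ℝ v x (EuclideanSpace.single (0 : Fin 3) (1 : ℝ)) 2))|)) := by ring
  have e3 : (64 * |(∫ x, ⟪curl v x, fderiv ℝ v x (curl v x)⟫)| / lam + 2 * ((sInf {κ : ℝ | (∀ (v : EuclideanSpace ℝ (Fin 3) → EuclideanSpace ℝ (Fin 3)) (M B : ℝ), ContDiff ℝ (⊤ : ℕ∞) v → Literature.Analysis.FluidPDE.VectorCalculus.IsDivFree v → (∀ x, ‖v x‖ ≤ M) → (∀ x, ‖fderiv ℝ v x‖ ≤ B) → (∫⁻ x, ‖iteratedFDeriv ℝ 0 v x‖ₑ ^ 2 < ⊤) → (∫⁻ x, ‖iteratedFDeriv ℝ 1 v x‖ₑ ^ 2 < ⊤) → (∫⁻ x, ‖iteratedFDeriv ℝ 2 v x‖ₑ ^ 2 < ⊤) → |∫ x, ⟪Literature.Analysis.FluidPDE.curl v x, fderiv ℝ v x (Literature.Analysis.FluidPDE.curl v x)⟫_ℝ| ≤ κ * M * Real.sqrt (∫ x, ‖Literature.Analysis.FluidPDE.curl v x‖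 ^ 2) * Real.sqrt (∫ x, Literature.Analysis.FluidPDE.frobeniusNormSq (fderiv ℝ (Literature.Analysis.FluidPDE.curl v) x)))})) ^ 2 * (∫ x, ‖curl v x‖ ^ 2)) * (∫ x : EuclideanSpace ℝ (Fin 3), deriv g (x 2) * frobeniusNormSq (fderiv ℝ v x) ^ 2) = (64 * |(∫ x, ⟪curl v x, fderiv ℝ v x (curl v x)⟫)| / lam) * (∫ x : EuclideanSpace ℝ (Fin 3), deriv g (x 2) * frobeniusNormSq (fderiv ℝ v x) ^ 2) + (2 * ((sInf {κ : ℝ | (∀ (v : EuclideanSpace ℝ (Fin 3) → EuclideanSpace ℝ (Fin 3)) (M B : ℝ), ContDiff ℝ (⊤ : ℕ∞) v → Literature.Analysis.FluidPDE.VectorCalculus.IsDivFree v → (∀ x, ‖v x‖ ≤ M) → (∀ x, ‖fderiv ℝ v x‖ ≤ B) → (∫⁻ x, ‖iteratedFDeriv ℝ 0 v x‖ₑ ^ 2 < ⊤) → (∫⁻ x, ‖iteratedFDeriv ℝ 1 v x‖ₑ ^ 2 < ⊤) → (∫⁻ x, ‖iteratedFDeriv ℝ 2 v x‖ₑ ^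 2 < ⊤) → |∫ x, ⟪Literature.Analysis.FluidPDE.curl v x, fderiv ℝ v x (Literature.Analysis.FluidPDE.curl v x)⟫_ℝ| ≤ κ * M * Real.sqrt (∫ x, ‖Literature.Analysis.FluidPDE.curl v x‖ ^ 2) * Real.sqrt (∫ x, Literature.Analysis.FluidPDE.frobeniusNormSq (fderiv ℝ (Literature.Analysis.FluidPDE.curl v) x)))})) ^ 2 * (∫ x, ‖curl v x‖ ^ 2)) * (∫ x : EuclideanSpace ℝ (Fin 3), deriv g (x 2) * frobeniusNormSq (fderiv ℝ v x) ^ 2) := by ring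
  linarith [hL, t1, t2, t3, e1, e2, e3]

end ExtremiserLiouville

end Summit.NavierStokesRegularity.NavierStokesRegularity.Theorems

end
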